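import Summits.SmoothPoincare4.SmoothPoincare4.Theses.InformationMetricHadamard
import Summits.SmoothPoincare4.SmoothPoincare4.Theorems.PICReduction
import Summits.SmoothPoincare4.SmoothPoincare4.Theorems.InformationMetricHadamardAhHadamardFillingStubCollarPackage
import Summits.SmoothPoincare4.SmoothPoincare4.Theorems.InformationMetricHadamardAhHadamardFillingStubHadamardConvexBodyBoundary
import Summits.SmoothPoincare4.SmoothPoincare4.Theorems.InformationMetricHadamardAhHadamardFillingStubLocallyConvexCore
import Summits.SmoothPoincare4.SmoothPoincare4.Theorems.InformationMetricHadamardAhHadamardFillingStubHadamardLocallyConvexIsConvexHelpers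
import Summits.SmoothPoincare4.SmoothPoincare4.Theorems.InformationMetricHadamardAhHadamardFillingStubHadamardLocallyConvexIsConvex
import Summits.SmoothPoincare4.SmoothPoincare4.Theorems.InformationMetricHadamardAhHadamardFillingStubLocallyConvexEndForcesHadamard

/-!
# Line `Sketch` — skeleton for crux `InformationMetricHadamard.AhHadamardFilling` (reshape r4: K1 landed p113043 and imported; the ONLY open stub is X = `stub_tameFillingNoPi1`, and X ↔ `SmoothPoincare4` by the c1 hardness sandwich)

(item stmt-SmoothPoincare4-6014, route `InformationMetricHadamard`, rank 2; idea card
`Cruxes/AhHadamardFilling/Ideas/convex-slice-lifts-to-cover.md`, planner sketch attached as evidence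
`20260816T113052Z-Sketch.lean`; skeleton owned by the line lead
`prover-line-stmt-SmoothPoincare4-6014-0` (r1–r3) and its continuation
`prover-line-stmt-SmoothPoincare4-6014-c1-0` (r4), 2026-08-16. Reshape r1: the card's stub K1
(`LocallyConvexEndForcesHadamard`) was proved from four registered stubs — two classical convexity
theorems of Hadamard geometry (A1, A2), the abstract core reduction and the collar package; r2/r3
landed all four and K1 itself; r4 imports the landed K1
(`Theorems/InformationMetricHadamardAhHadamardFillingStubLocallyConvexEndForcesHadamard.lean`), so the
composition below now rests on exactly ONE `sorry`: the open stub X.)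

Crux (fixed, never restated): every homotopy 4-sphere `Σ` carries a Riemannian metric `g` and is the
cross-section of a proper end collar `Φ : Σ × (0,1) → W` of a Cartan–Hadamard 5-manifold `(W, G)`
(complete, simply connected, `sec ≤ 0`) on which `G` is `C⁰`-asymptotic to `c (dλ² + g)/λ²`.

## The line: convex far slices lift to the universal cover (Alexander 1977, made synthetic)

Registered stubs (`K_t := (Φ '' (univ ×ˢ Ioo 0 t))ᶜ` throughout):

* `stub_hadamardLocallyConvexIsConvex` (A1; L; H. Karcher, Math. Ann. 177 (1968) 105–121 —
  Tietze–Nakajima in a Cartan–Hadamard manifold): in a complete simply connected 5-manifold with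
  `sec ≤ 0`, a closed connected locally `d`-convex set (betweenness form, pointwise radius) is
  `d`-convex.
* `stub_hadamardConvexBodyBoundary` (A2; L–XL; = route item 6016 `HadamardConvexBoundarySphere`
  strengthened; Lee 2018 Thm. 12.8 / Prop. 12.9, radial projection from an interior point): a closed
  `d`-convex set with nonempty interior whose frontier contains, as a relatively open subset, the
  image of an injective immersion of a nonempty compact 4-manifold `N`, is compact, its frontier IS
  that image, and `N ≅ S⁴`.
* `stub_locallyConvexCoreForcesHadamard` (core; PROVED by wave 1, 1213-line sorry-free work file,
  to land): from A1, A2 — a complete connected `(W, G)` with `sec ≤ 0` containing a closed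
  `δ`-locally `d`-convex `K` with nonempty interior onto which `W` deformation retracts, whose
  frontier is an injectively immersed simply connected closed 4-manifold `T`, is simply connected and
  `T ≅ S⁴` (lift to the universal Riemannian covering `exp_p : (ℝ⁵, exp_p^* G) → W`, which the
  tree's `SimpleAH.exp_covering_of_complete` provides; `exp_p⁻¹ K` is closed, connected, locally
  convex, so convex by A1; one sheet over `∂K` is a relatively open compact piece of `∂(exp_p⁻¹ K)`,
  so by A2 it is all of it; a fibre is a point, `W ≃ₜ ℝ⁵`).
* `stub_collarPackage` (collar bookkeeping; PROVED by wave 1, to land): for the crux's collar data,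
  `Σ ≠ ∅` and simply connected, the far parts are open, `∂K_t = Φ(Σ × {t})`, `W` deformation
  retracts vertically onto `K_t`, and the slice `σ ↦ Φ(σ,t)` is a smooth immersion.
* `stub_tameFillingNoPi1` (X; the OPEN content, summit-strength): every homotopy 4-sphere admits
  the data of the crux with `SimplyConnectedSpace W` weakened to `ConnectedSpace W`, plus an
  immersive collar and a `δ`-locally `d`-convex far complement.

Landed (all ACCEPTED, imported above): A1 toolkit p107611, A1 p109594, A2 p107417, core p108615,
collar package p106081, K1 p113043 (`stub_locallyConvexEndForcesHadamard`, with
`locallyConvexEndForcesHadamard_of_facts`).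

Proved here (no `sorry` of their own): `AhHadamardFilling_of` (the crux BY NAME, from X and the
landed K1), `smoothPoincare4_of_stubs` (hardness record: X and the landed K1 imply the summit, so X
cannot land short of SPC4).

## Hardness sandwich (lead c1; tree theorems): the open stub X is EXACTLY the summit

* `Theorems/InformationMetricHadamardAhHadamardFillingReduction.lean`: `ahHadamardFilling_of_tameFillingNoPi1`
  (X → crux), `smoothPoincare4_of_tameFillingNoPi1` (X → `SmoothPoincare4`);
* `Theorems/AhHadamardFilling/Negative/OfSmoothPoincare4.lean`: `ahHadamardFilling_of_smoothPoincare4`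
  (`SmoothPoincare4` → crux; witness `W = ℍ⁵` = `Hyperboloid.metric ⊤` on `⊤ : Opens ℝ⁵`, cone collar
  `Φ(σ,λ) = λ⁻¹ f(σ)` over `S ≅ S⁴ ⊂ ℝ⁵`, `c = 1`), `not_smoothPoincare4_of_not_ahHadamardFilling`;
* `Theorems/AhHadamardFilling/Negative/TameFillingOfSmoothPoincare4.lean`: `tameFillingNoPi1_of_smoothPoincare4`
  (`SmoothPoincare4` → X, all clauses: immersive collar, far complement `{‖u‖ ≤ 2}` totally convex);
* supporting: `Literature/Geometry/Riemannian/HyperboloidCartanHadamard.lean` (ℍⁿ is Cartan–Hadamard),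
  `Theorems/AhHadamardFilling/Negative/HyperbolicConeCollar.lean` (collar clauses, exact metric identity,
  `C⁰` cone asymptotics).

Hence X ↔ `SmoothPoincare4` and `SmoothPoincare4` → crux: refuting X or the crux means exhibiting an
exotic 4-sphere, proving X means proving SPC4; no worker, fact or computation can move X.

## Disproof.lean honoured

None exists for this crux yet (`ledger crux ls`, 2026-08-16T17:40Z: Ideas, Lines/Sketch.lean,
PICKED.md only).
-/

noncomputable section

-- the prescribed namespace `Summit.<P>.<Sub>.…` duplicates `SmoothPoincare4` (P = Sub)
set_option linter.dupNamespace false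

open scoped Manifold ContDiff Topology ENNReal NNReal
open Set Function

namespace Summit.SmoothPoincare4.SmoothPoincare4.Cruxes.AhHadamardFilling.Sketch

open Literature.Topology.FourManifolds (HomotopySphere)
open Literature.Geometry.Lorentzian (PseudoRiemannianMetric)

/-! ## Stub A1-toolkit — LANDED: `stub_hadamardConvexityToolkit` (p107611,
`Theorems/InformationMetricHadamardAhHadamardFillingStubHadamardLocallyConvexIsConvexHelpers.lean`, imported) -/

/-! ## Stub A1 — LANDED: `stub_hadamardLocallyConvexIsConvex` (p109594,
`Theorems/InformationMetricHadamardAhHadamardFillingStubHadamardLocallyConvexIsConvex.lean`, imported) -/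

/-! ## Stub A2 — LANDED: `stub_hadamardConvexBodyBoundary` (p107417,
`Theorems/InformationMetricHadamardAhHadamardFillingStubHadamardConvexBodyBoundary.lean`, imported) -/

/-! ## Stub core — LANDED: `stub_locallyConvexCoreForcesHadamard` (p108615,
`Theorems/InformationMetricHadamardAhHadamardFillingStubLocallyConvexCore.lean`, imported; its generic layers are
`Literature/Geometry/Riemannian/HadamardExpCovering.lean` p104436 and
`Literature/Topology/CoveringSpaces/CoveringSubsingletonFiber.lean` p104426) -/

/-! ## Stub collar package — LANDED: `stub_collarPackage` (p106081,
`Theorems/InformationMetricHadamardAhHadamardFillingStubCollarPackage.lean`, imported) -/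

/-! ## Stub X — the tame filling without `π₁` (the open content of the crux) -/

/-- **X (`TameFillingNoPi1`).** Every homotopy 4-sphere `S` carries a Riemannian metric `g` and is
the cross-section of a proper smooth injective immersive end collar `Φ` of a complete CONNECTED
Riemannian 5-manifold `(W, G)` with `sec ≤ 0`, whose far complement `K_t` is, for some `t`, of
nonempty interior and `δ`-locally `d`-convex, and on which `G` is `C⁰`-asymptotic to
`c (dλ² + g)/λ²` — every clause of the crux except simple connectivity, plus immersivity and local
convexity. Intended witness: the collar component of `M₁(S,[g])` with Hitchin's information metric
(Groisser–Murray 1997 Thm. 3.1 for completeness and the `C⁰` clause; `sec(g_I) ≤ 0`, nondegeneracy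
and the `C¹` collar upgrade are the informal route items 7336/7372). SUMMIT-STRENGTH: with K1 it
implies `SmoothPoincare4` (`smoothPoincare4_of_stubs` below). -/
theorem stub_tameFillingNoPi1 (S : HomotopySphere 4) :
    ∃ (g : PseudoRiemannianMetric (𝓡 4) ∞ (EuclideanSpace ℝ (Fin 4)) (TangentSpace (𝓡 4) : S.carrier → Type _))
      (_ : g.IsRiemannian) (W : Type) (_ : TopologicalSpace W) (_ : T2Space W)
      (_ : SecondCountableTopology W) (_ : ChartedSpace (EuclideanSpace ℝ (Fin 5)) W) (_ : IsManifold (𝓡 5) ∞ W)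
      (_ : ConnectedSpace W)
      (G : PseudoRiemannianMetric (𝓡 5) ∞ (EuclideanSpace ℝ (Fin 5)) (TangentSpace (𝓡 5) : W → Type _))
      (hG : G.IsRiemannian) (c : ℝ) (Φ : S.carrier × ℝ → W),
      0 < c ∧
      (∀ (x : W) (r : NNReal), IsCompact {y : W | G.edist hG x y ≤ r}) ∧
      (∀ cov, G.IsLeviCivita cov →
        ∀ (x : W) (X Y : TangentSpace (𝓡 5) x), G.sectionalCurvature cov x X Y ≤ 0) ∧
      ContMDiffOn ((𝓡 4).prod 𝓘(ℝ, ℝ)) (𝓡 5) ∞ Φ (univ ×ˢ Ioo (0 : ℝ) 1) ∧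
      InjOn Φ (univ ×ˢ Ioo (0 : ℝ) 1) ∧
      (∀ p ∈ univ ×ˢ Ioo (0 : ℝ) 1,
        Function.Injective (mfderiv ((𝓡 4).prod 𝓘(ℝ, ℝ)) (𝓡 5) Φ p)) ∧
      (∀ t ∈ Ioo (0 : ℝ) 1, IsCompact (Φ '' (univ ×ˢ Ioo (0 : ℝ) t))ᶜ) ∧
      (∀ t ∈ Ioo (0 : ℝ) 1,
        closure (Φ '' (univ ×ˢ Ioo (0 : ℝ) t)) ⊆ Φ '' (univ ×ˢ Ioo (0 : ℝ) 1)) ∧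
      (∃ t ∈ Ioo (0 : ℝ) 1, ∃ δ : ℝ, 0 < δ ∧
        (interior (Φ '' (univ ×ˢ Ioo (0 : ℝ) t))ᶜ).Nonempty ∧
        ∀ p ∈ (Φ '' (univ ×ˢ Ioo (0 : ℝ) t))ᶜ, ∀ q ∈ (Φ '' (univ ×ˢ Ioo (0 : ℝ) t))ᶜ,
          G.edist hG p q < ENNReal.ofReal δ →
          ∀ m : W, G.edist hG p m + G.edist hG m q = G.edist hG p q →
            m ∈ (Φ '' (univ ×ˢ Ioo (0 : ℝ) t))ᶜ) ∧
      (∀ ε : ℝ, 0 < ε → ∃ t ∈ Ioo (0 : ℝ) 1, ∀ (x : S.carrier) (l : ℝ), l ∈ Ioo (0 : ℝ) t →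
        ∀ (v : TangentSpace (𝓡 4) x) (s : ℝ),
          |G.val (Φ (x, l)) (mfderiv ((𝓡 4).prod 𝓘(ℝ, ℝ)) (𝓡 5) Φ (x, l) (v, s))
              (mfderiv ((𝓡 4).prod 𝓘(ℝ, ℝ)) (𝓡 5) Φ (x, l) (v, s)) -
            c * (s ^ 2 + g.val x v v) / l ^ 2| ≤ ε * (c * (s ^ 2 + g.val x v v) / l ^ 2)) := by
  sorry

/-! ## Stub K1 — LANDED: `stub_locallyConvexEndForcesHadamard` (p113043,
`Theorems/InformationMetricHadamardAhHadamardFillingStubLocallyConvexEndForcesHadamard.lean`, imported; assembled from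
the landed A1, A2, core and collar package by `locallyConvexEndForcesHadamard_of_facts`) -/

/-! ## The composition (kernel-checked; no `sorry` of its own) -/

/-- **The line concludes the crux BY NAME.** X supplies, for the given homotopy sphere, the metric
`g`, the connected complete filling `(W, G)` with `sec ≤ 0`, the constant `c` and the collar `Φ` with
every clause of the crux plus immersivity and a locally convex far complement; K1 turns
`ConnectedSpace W` into `SimplyConnectedSpace W`; the remaining clauses are passed through. -/
theorem AhHadamardFilling_of :
    Summit.SmoothPoincare4.SmoothPoincare4.Theses.InformationMetricHadamard.AhHadamardFilling := by
  intro S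
  obtain ⟨g, hg, W, i1, i2, i3, i4, i5, i6, G, hG, c, Φ, hc, hcpt, hsec, hsm, hinj, himm, hco, hcl,
    hconv, hasym⟩ := stub_tameFillingNoPi1 S
  have hK := stub_locallyConvexEndForcesHadamard S W G hG Φ hcpt hsec hsm hinj himm hco hcl hconv
  haveI : SimplyConnectedSpace W := hK.1
  exact ⟨g, hg, W, i1, i2, i3, i4, i5, inferInstance, G, hG, c, Φ, hc, hcpt, hsec, hsm, hinj, hco,
    hcl, hasym⟩

/-! ## Hardness record: the stubs imply the summit -/

/-- **The stubs imply `SmoothPoincare4`.** K1's second conclusion `S ≅ S⁴`, fed with X's data for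
every homotopy 4-sphere `S`, is the hypothesis of
`Literature.SPC4.smoothPoincare4_of_forall_homotopySphere` (with the proved packaging facts
`compactSpace_of_homotopyEquiv_sphere_four_holds` / `isOrientable_of_homotopyEquiv_sphere_four_holds`).
Hence `stub_tameFillingNoPi1` is summit-strength given the provable K1: the line cannot close the
crux short of settling SPC4. (Pure logic; recorded for the lead's `promote-stub` evidence.) -/
theorem smoothPoincare4_of_stubs : _root_.SmoothPoincare4 := by
  refine Literature.SPC4.smoothPoincare4_of_forall_homotopySphere
    Literature.Topology.FourManifolds.compactSpace_of_homotopyEquiv_sphere_four_holds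
    Literature.Topology.FourManifolds.isOrientable_of_homotopyEquiv_sphere_four_holds ?_
  intro S
  obtain ⟨g, hg, W, i1, i2, i3, i4, i5, i6, G, hG, c, Φ, hc, hcpt, hsec, hsm, hinj, himm, hco, hcl,
    hconv, hasym⟩ := stub_tameFillingNoPi1 S
  exact (stub_locallyConvexEndForcesHadamard S W G hG Φ hcpt hsec hsm hinj himm hco hcl hconv).2

end Summit.SmoothPoincare4.SmoothPoincare4.Cruxes.AhHadamardFilling.Sketch

end
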